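import Literature.MathematicalPhysics.QuantumLattice.MerminWagnerPeriodicEquilibriumStates
import Literature.MathematicalPhysics.QuantumLattice.HubbardGroundStateMultipletExpectations
import Literature.MathematicalPhysics.QuantumLattice.PeriodicSublatticeAndStaggeredTerms
import Literature.MathematicalPhysics.QuantumLattice.PeriodicPressureSuperlatticeIndependence
import HarnessLib

/-!
# No magnetic order of any kind or period in the two-dimensional `SU(2)`-symmetric `t–t'` Hubbard model at `T > 0`
# (Ghosh 1971 / Koma–Tasaki 1992 via Klein–Landau–Shucker): `ω(S^z_x) = ω(S^±_x) = 0`, staggered magnetisation `= 0`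

Topic `Literature/MathematicalPhysics/QuantumLattice` (family `hubbard`; the `SU(2)` instance of `MerminWagnerPeriodicEquilibriumStates`).

**Ghosh, Phys. Rev. Lett. 27 (1971) 1584; Koma–Tasaki, Phys. Rev. Lett. 68 (1992) 3248**: the one- and two-dimensional Hubbard
models have no magnetic ordering at any `T > 0` (Bogoliubov's inequality / the Mermin–Wagner argument for the `SU(2)` spin
symmetry; Koma–Tasaki add the `U(1)` pairing symmetry and quantitative decay). Klein–Landau–Shucker (J. Stat. Phys. 26 (1981) 505)
give the infinite-volume form: every two-dimensional equilibrium state is invariant under every conserved continuous on-site symmetry.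

This file PROVES, for the grand-canonical `t–t'` Hubbard interaction `gcInteractionTT' t t' U μ 0` on `ℤ²` WITHOUT Zeeman field
(`h = 0`, any real `t, t', U, μ`), every `β ≥ 0`, every period vector `q` and every `q`-periodic equilibrium state `ω`
(`ω.IsPerVarEquilibrium β q (gcInteractionTT' t t' U μ 0) 1`, `PeriodicVariationalEquilibria`):

* §1 the spin-flip algebra: `[n_{p↑}+n_{p↓}, S^±] = 0`, the hopping and Hubbard terms commute with the spin-flip charge `S⁺ + S⁻ = 2S^x`
  (from Lieb's `[H, S⁺] = 0` lemmas `LiebThm1.sum_hopping_commute_spinPlus`, `…numberOp_mul_numberOp_commute_spinPlus`), and the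
  charged combinations `[S⁺+S⁻, 2S^z_p ± (S⁺_p − S⁻_p)] = ∓2 (2S^z_p ± (S⁺_p − S⁻_p))`;
* §2 the on-site spin-flip charge `q₀ = S⁺_0 + S⁻_0 ∈ 𝔄_{{0}}` (even, Hermitian), `Q_Λ = S⁺_Λ + S⁻_Λ`
  (`chargeSum_spinFlipCharge`), conserved by every term of `gcInteractionTT' t t' U μ 0` (`commute_chargeSum_spinFlipCharge_gcInteractionTT'`);
* §3 **`IsPerVarEquilibrium.expect_eq_zero_of_spinFlipCharged_ttPrime`**: `ω(O) = 0` for every local `O` with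
  `(S⁺_Λ+S⁻_Λ)O − O(S⁺_Λ+S⁻_Λ) = κO`, `κ ≠ 0`; hence **`…expect_sZAt_eq_zero_ttPrime`** `ω(S^z_x) = 0`,
  **`…expect_nAt_sub_nAt_eq_zero_ttPrime`** `ω(n_{x↑} − n_{x↓}) = 0`, `…expect_sPlusAt_eq_zero_ttPrime` / `…sMinusAt…` `ω(S^±_x) = 0`
  for EVERY site `x` of every region, and **`…staggeredMagnetisation_eq_zero_ttPrime`**: the staggered magnetisation
  (`InfVolFermionState.staggeredMagnetisation`, `PeriodicSublatticeAndStaggeredTerms`) of every periodic equilibrium state vanishes —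
  no ferro-, antiferro- (Néel), ferri-, spiral or stripe magnetisation of any period at any `T > 0`; §4 the translation-invariant
  equilibrium states (`IsVarEquilibrium`) as the special case; §5 the `(2ℤ)²`-periodic staggered-field family `hubbardStaggered 2 t U θ` of
  `PeriodicSublatticeAndStaggeredTerms` at zero staggered field `θ₁ = 0` (`= gcInteractionTT' t 0 U (−θ₀) 0`): its periodic equilibrium states
  have `staggeredMagnetisation = 0` (`…staggeredMagnetisation_eq_zero_hubbardStaggered`).

Everything is PROVED (standard axioms); no definition, no named fact.

## References

* D. K. Ghosh, *Nonexistence of magnetic ordering in the one- and two-dimensional Hubbard model*, Phys. Rev. Lett. 27 (1971) 1584–1587.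
  [cite: Ghosh1971]
* T. Koma, H. Tasaki, Phys. Rev. Lett. 68 (1992) 3248–3251. [cite: KomaTasakiPRL1992, p. 3]
* A. Klein, L. J. Landau, D. S. Shucker, J. Stat. Phys. 26 (1981) 505–512. [cite: KleinLandauShucker1981]
* E. H. Lieb, Phys. Rev. Lett. 62 (1989) 1201, eq. (2) (`[H, S] = 0`). [cite: LiebPRL1989, eq. (2)]
* F. H. L. Essler et al., *The one-dimensional Hubbard model* (2005), §2.2.5 eqs. (2.71)–(2.73) (local spin operators).
  [cite: EsslerEtAl2005, §2.2.5 eq. (2.66) and (2.71)–(2.73)]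
-/

noncomputable section

open scoped ComplexOrder BigOperators Matrix.Norms.L2Operator
open Finset Literature.InformationTheory.Entropy

namespace Literature.MathematicalPhysics.QuantumLattice

open Matrix Literature.Probability.LatticeModels ThermodynamicLimit HubbardWave0 LiebThm1
open _root_.Filter
open scoped _root_.Topology

variable {d : ℕ}

/-! ### §1 The spin-flip algebra on a finite set of sites -/

/-- Adjoints of commuting matrices commute. [folklore] -/
private theorem commute_conjTranspose' {n : Type*} [Fintype n] {A B : Matrix n n ℂ} (h : Commute A B) : Commute Aᴴ Bᴴ := by
  have h' := congrArg conjTranspose h.eq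
  rw [conjTranspose_mul, conjTranspose_mul] at h'
  exact h'.symm

section Algebra

variable {Λ : Type*} [LinearOrder Λ] [Fintype Λ]

/-- `[n_{pσ}, S⁺]`: `[n_{p↑}, S⁺] = S⁺_p`, `[n_{p↓}, S⁺] = -S⁺_p`. [cite: EsslerEtAl2005, §2.2.5 eq. (2.66) and (2.71)–(2.73)] -/
theorem numberOp_mul_spinPlus_sub (p : Λ) (σ : Fin 2) :
    numberOp p σ * spinPlus - spinPlus * numberOp p σ =
      (if σ = 0 then fermionSpinPlus p else -fermionSpinPlus p : Matrix (Finset (Orb Λ)) (Finset (Orb Λ)) ℂ) := by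
  rw [← sum_fermionSpinPlus, Finset.mul_sum, Finset.sum_mul, ← Finset.sum_sub_distrib]
  simp only [numberOp, fermionSpinPlus, LiebThm1.creation_mul_annihilation_commutator, orb_eq_orb_iff]
  fin_cases σ
  · simp [Finset.sum_ite_eq]
  · simp [Finset.sum_ite_eq]

/-- **The site occupation commutes with the spin-raising operator**: `[n_{p↑} + n_{p↓}, S⁺] = 0` (a spin flip keeps the number of
particles at every site). [cite: LiebPRL1989, eq. (2)] -/
theorem numberOp_add_numberOp_commute_spinPlus (p : Λ) :
    Commute (numberOp p 0 + numberOp p 1) (spinPlus : Matrix (Finset (Orb Λ)) (Finset (Orb Λ)) ℂ) := by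
  have h0 := numberOp_mul_spinPlus_sub p 0
  have h1 := numberOp_mul_spinPlus_sub p 1
  rw [if_pos rfl] at h0
  rw [if_neg (by decide)] at h1
  rw [Commute, SemiconjBy, ← sub_eq_zero, Matrix.add_mul, Matrix.mul_add,
    show numberOp p 0 * spinPlus + numberOp p 1 * spinPlus - (spinPlus * numberOp p 0 + spinPlus * numberOp p 1) =
      (numberOp p 0 * spinPlus - spinPlus * numberOp p 0) + (numberOp p 1 * spinPlus - spinPlus * numberOp p 1) by abel,
    h0, h1, add_neg_cancel]

/-- `[n_{p↑} + n_{p↓}, S⁻] = 0`. [cite: LiebPRL1989, eq. (2)] -/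
theorem numberOp_add_numberOp_commute_spinMinus (p : Λ) :
    Commute (numberOp p 0 + numberOp p 1) (spinMinus : Matrix (Finset (Orb Λ)) (Finset (Orb Λ)) ℂ) := by
  have h0 := numberOp_mul_spinMinus_sub p 0
  have h1 := numberOp_mul_spinMinus_sub p 1
  rw [if_pos rfl] at h0
  rw [if_neg (by decide)] at h1
  rw [Commute, SemiconjBy, ← sub_eq_zero, Matrix.add_mul, Matrix.mul_add,
    show numberOp p 0 * spinMinus + numberOp p 1 * spinMinus - (spinMinus * numberOp p 0 + spinMinus * numberOp p 1) =
      (numberOp p 0 * spinMinus - spinMinus * numberOp p 0) + (numberOp p 1 * spinMinus - spinMinus * numberOp p 1) by abel,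
    h0, h1, neg_add_cancel]

/-- **The spin-flip charge commutes with the Hubbard hopping term**: `[S⁺ + S⁻, Σ_σ (c†_{pσ}c_{p'σ} + c†_{p'σ}c_{pσ})] = 0`
(Lieb's `[Σ_σ c†_{pσ}c_{p'σ}, S⁺] = 0` and its adjoint). [cite: LiebPRL1989, eq. (2)] -/
theorem spinFlip_commute_hopping (p p' : Λ) :
    Commute (spinPlus + spinMinus : Matrix (Finset (Orb Λ)) (Finset (Orb Λ)) ℂ)
      (∑ σ : Fin 2, (creation (orb p σ) * annihilation (orb p' σ) + creation (orb p' σ) * annihilation (orb p σ))) := by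
  -- the adjoint of Lieb's lemma: `Σ_σ c†_{aσ} c_{bσ}` commutes with `S⁻`
  have hM : ∀ a b : Λ, Commute (∑ σ : Fin 2, creation (orb a σ) * annihilation (orb b σ))
      (spinMinus : Matrix (Finset (Orb Λ)) (Finset (Orb Λ)) ℂ) := by
    intro a b
    have h := commute_conjTranspose' (sum_hopping_commute_spinPlus b a)
    rw [Matrix.conjTranspose_sum] at h
    simp only [conjTranspose_mul, creation_conjTranspose, annihilation_conjTranspose] at h
    exact h
  rw [Finset.sum_add_distrib]
  exact Commute.add_right (Commute.add_left (sum_hopping_commute_spinPlus p p').symm (hM p p').symm)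
    (Commute.add_left (sum_hopping_commute_spinPlus p' p).symm (hM p' p).symm)

/-- **The spin-flip charge commutes with the Hubbard repulsion**: `[S⁺ + S⁻, n_{p↑}n_{p↓}] = 0`. [cite: LiebPRL1989, eq. (2)] -/
theorem spinFlip_commute_numberOp_mul_numberOp (p : Λ) :
    Commute (spinPlus + spinMinus : Matrix (Finset (Orb Λ)) (Finset (Orb Λ)) ℂ) (numberOp p 0 * numberOp p 1) := by
  have hP := numberOp_mul_numberOp_commute_spinPlus p
  have hM : Commute (numberOp p 0 * numberOp p 1) (spinMinus : Matrix (Finset (Orb Λ)) (Finset (Orb Λ)) ℂ) := by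
    have h := commute_conjTranspose' hP
    simp only [numberOp, conjTranspose_mul, creation_conjTranspose, annihilation_conjTranspose] at h
    -- `(n↑ n↓)ᴴ = n↓ n↑ = n↑ n↓`
    have hc : creation (orb p 1) * annihilation (orb p 1) * (creation (orb p 0) * annihilation (orb p 0)) =
        creation (orb p 0) * annihilation (orb p 0) * (creation (orb p 1) * annihilation (orb p 1)) := by
      rw [← numberAt, ← numberAt, (numberAt_commute _ _).eq]
    rw [hc] at h
    exact h
  exact Commute.add_left hP.symm hM.symm

/-- **The spin-flip charge commutes with the site occupation**: `[S⁺ + S⁻, n_{p↑} + n_{p↓}] = 0`. [cite: LiebPRL1989, eq. (2)] -/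
theorem spinFlip_commute_numberOp_add_numberOp (p : Λ) :
    Commute (spinPlus + spinMinus : Matrix (Finset (Orb Λ)) (Finset (Orb Λ)) ℂ) (numberOp p 0 + numberOp p 1) :=
  Commute.add_left (numberOp_add_numberOp_commute_spinPlus p).symm (numberOp_add_numberOp_commute_spinMinus p).symm

/-- **The longitudinal observables are charged under the spin flip**: with `Q = S⁺ + S⁻` and `O₋ = 2S^z_p + (S⁺_p − S⁻_p)`,
`Q O₋ − O₋ Q = −2 O₋` (`[S^z_p,S^±] = ±S^±_p`, `[S⁺_p,S⁻] = 2S^z_p`, `[S^±_p, S^±] = 0`).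
[cite: EsslerEtAl2005, §2.2.5 eq. (2.66) and (2.71)–(2.73)] -/
theorem spinFlip_commutator_longitudinal_minus (p : Λ) :
    (spinPlus + spinMinus : Matrix (Finset (Orb Λ)) (Finset (Orb Λ)) ℂ) *
          ((2 : ℂ) • fermionSpinZ p + (fermionSpinPlus p - fermionSpinMinus p)) -
        ((2 : ℂ) • fermionSpinZ p + (fermionSpinPlus p - fermionSpinMinus p)) * (spinPlus + spinMinus) =
      (-2 : ℂ) • ((2 : ℂ) • fermionSpinZ p + (fermionSpinPlus p - fermionSpinMinus p)) := by
  have h1 := fermionSpinZ_mul_spinPlus_sub p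
  have h2 := fermionSpinZ_mul_spinMinus_sub p
  have h3 := fermionSpinPlus_commute_spinPlus p
  have h4 := fermionSpinPlus_mul_spinMinus_sub p
  have h5 := fermionSpinMinus_mul_spinPlus_sub p
  have h6 := fermionSpinMinus_commute_spinMinus p
  rw [sub_eq_iff_eq_add'] at h1 h2 h4 h5
  simp only [Matrix.add_mul, Matrix.mul_add, Matrix.sub_mul, Matrix.mul_sub, Matrix.smul_mul, Matrix.mul_smul, h1, h2, h3, h4,
    h5, h6]
  module

/-- `Q O₊ − O₊ Q = 2 O₊` for `O₊ = 2S^z_p − (S⁺_p − S⁻_p)`. [cite: EsslerEtAl2005, §2.2.5 eq. (2.66) and (2.71)–(2.73)] -/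
theorem spinFlip_commutator_longitudinal_plus (p : Λ) :
    (spinPlus + spinMinus : Matrix (Finset (Orb Λ)) (Finset (Orb Λ)) ℂ) *
          ((2 : ℂ) • fermionSpinZ p - (fermionSpinPlus p - fermionSpinMinus p)) -
        ((2 : ℂ) • fermionSpinZ p - (fermionSpinPlus p - fermionSpinMinus p)) * (spinPlus + spinMinus) =
      (2 : ℂ) • ((2 : ℂ) • fermionSpinZ p - (fermionSpinPlus p - fermionSpinMinus p)) := by
  have h1 := fermionSpinZ_mul_spinPlus_sub p
  have h2 := fermionSpinZ_mul_spinMinus_sub p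
  have h3 := fermionSpinPlus_commute_spinPlus p
  have h4 := fermionSpinPlus_mul_spinMinus_sub p
  have h5 := fermionSpinMinus_mul_spinPlus_sub p
  have h6 := fermionSpinMinus_commute_spinMinus p
  rw [sub_eq_iff_eq_add'] at h1 h2 h4 h5
  simp only [Matrix.add_mul, Matrix.mul_add, Matrix.sub_mul, Matrix.mul_sub, Matrix.smul_mul, Matrix.mul_smul, h1, h2, h3, h4,
    h5, h6]
  module

end Algebra

/-! ### §2 The on-site spin-flip charge and its conservation by the zero-field `t–t'` Hubbard interaction -/

/-- **The spin-flip charge** `q₀ = S⁺_0 + S⁻_0 = 2 S^x_0 ∈ 𝔄_{{0}}` (generator of the spin rotations about the `x` axis) is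
Hermitian. [cite: EsslerEtAl2005, §2.2.5 eq. (2.66) and (2.71)–(2.73)] -/
theorem spinFlipCharge_isHermitian (d : ℕ) :
    (sPlusAt 0 (Finset.mem_singleton_self 0) + sMinusAt 0 (Finset.mem_singleton_self 0) : FermionOp ({0} : Finset (Site d))).IsHermitian := by
  rw [Matrix.IsHermitian, conjTranspose_add, sPlusAt, sMinusAt, conjTranspose_fermionSpinPlus, conjTranspose_fermionSpinMinus, add_comm]

/-- The spin-flip charge `S⁺_0 + S⁻_0` is even. [cite: ArakiMoriya2003, §4.1 Def. 4.5] -/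
theorem parityAut_spinFlipCharge (d : ℕ) :
    parityAut (sPlusAt 0 (Finset.mem_singleton_self 0) + sMinusAt 0 (Finset.mem_singleton_self 0) : FermionOp ({0} : Finset (Site d))) =
      sPlusAt 0 (Finset.mem_singleton_self 0) + sMinusAt 0 (Finset.mem_singleton_self 0) := by
  rw [map_add, sPlusAt, sMinusAt, fermionSpinPlus, fermionSpinMinus, map_mul, map_mul, parityAut_creation,
    parityAut_annihilation, parityAut_creation, parityAut_annihilation, neg_mul_neg, neg_mul_neg]

/-- The translation of the origin to `x ∈ Λ`, as an ordered site of `Λ`. [cite: ArakiMoriya2003, §4.1 Def. 4.3] -/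
private theorem shiftEmb_trans_incl_pt_zero {Λ : Finset (Site d)} {x : Site d} (hx : x ∈ Λ) :
    ((PolySite.shiftEmb x {0}).trans (PolySite.incl (shiftSet_zero_singleton_subset hx))) (PolySite.pt 0 (Finset.mem_singleton_self 0)) =
      PolySite.pt x hx := by
  apply Subtype.ext
  simp only [Function.Embedding.trans_apply, PolySite.shiftEmb_pt, PolySite.incl_pt]
  show toLex ((0 : Site d) + x) = toLex x
  rw [zero_add]

/-- **`q_x = S⁺_x + S⁻_x`** for the spin-flip charge `q₀ = S⁺_0 + S⁻_0`. [cite: KleinLandauShucker1981] -/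
theorem chargeAt_spinFlipCharge {Λ : Finset (Site d)} {x : Site d} (hx : x ∈ Λ) :
    chargeAt (sPlusAt 0 (Finset.mem_singleton_self 0) + sMinusAt 0 (Finset.mem_singleton_self 0) : FermionOp ({0} : Finset (Site d))) Λ x =
      sPlusAt x hx + sMinusAt x hx := by
  rw [chargeAt_of_mem _ hx, map_add, sPlusAt, sMinusAt, fermionEmbed_fermionSpinPlus, fermionEmbed_fermionSpinMinus,
    shiftEmb_trans_incl_pt_zero hx]

/-- Reindexing a sum over the sites of `Λ` as a sum over the ordered sites. [cite: BratteliRobinsonII1997, §6.2.1] -/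
private theorem sum_attach_eq_sum_polySite'' (Λ : Finset (Site d)) (F : PolySite Λ → FermionOp Λ) :
    ∑ x ∈ Λ.attach, F (PolySite.pt x.1 x.2) = ∑ y : PolySite Λ, F y := by
  classical
  let e : PolySite Λ ≃ {x // x ∈ Λ} :=
    ⟨fun a => ⟨ofLex a.1, PolySite.ofLex_mem a⟩, fun x => PolySite.pt x.1 x.2, fun a => PolySite.pt_ofLex a,
      fun x => Subtype.ext rfl⟩
  rw [← Finset.univ_eq_attach]
  exact (Fintype.sum_equiv e _ _ fun a => by
    rw [show PolySite.pt (e a).1 (e a).2 = e.symm (e a) from rfl, Equiv.symm_apply_apply]).symm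

/-- **`Q_Λ = S⁺_Λ + S⁻_Λ`**: the total spin-flip charge of a region. [cite: KleinLandauShucker1981] -/
theorem chargeSum_spinFlipCharge (Λ : Finset (Site d)) :
    chargeSum (sPlusAt 0 (Finset.mem_singleton_self 0) + sMinusAt 0 (Finset.mem_singleton_self 0) : FermionOp ({0} : Finset (Site d))) Λ =
      (spinPlus + spinMinus : FermionOp Λ) := by
  classical
  rw [chargeSum, ← sum_fermionSpinPlus, ← sum_fermionSpinMinus, ← Finset.sum_add_distrib,
    ← sum_attach_eq_sum_polySite'' Λ (fun y => fermionSpinPlus y + fermionSpinMinus y), ← Finset.sum_attach Λ]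
  refine Finset.sum_congr rfl fun x _ => ?_
  rw [chargeAt_spinFlipCharge x.2]

/-- **The zero-field `t–t'` Hubbard interaction conserves the spin-flip charge, term by term**:
`(S⁺_Z + S⁻_Z) Φ(Z) = Φ(Z) (S⁺_Z + S⁻_Z)` for `Ψ = gcInteractionTT' t t' U μ 0` (hopping, repulsion and chemical potential are
`SU(2)` scalars; the Zeeman term is absent). [cite: LiebPRL1989, eq. (2)] [cite: Ghosh1971] -/
theorem commute_chargeSum_spinFlipCharge_gcInteractionTT' (t t' U μ : ℝ) (Z : Finset (Site 2)) :
    Commute (chargeSum (sPlusAt 0 (Finset.mem_singleton_self 0) + sMinusAt 0 (Finset.mem_singleton_self 0) : FermionOp ({0} : Finset (Site 2))) Z)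
      ((gcInteractionTT' t t' U μ 0).Φ Z) := by
  rw [chargeSum_spinFlipCharge, gcInteractionTT', FermionInteraction.linearFamily_apply, hubbardTTPrimeFermionInteraction_apply,
    Fin.sum_univ_two]
  simp only [Matrix.cons_val_zero, Matrix.cons_val_one, neg_zero, Complex.ofReal_zero, zero_smul, add_zero]
  refine Commute.add_right (Commute.add_right ?_ ?_) (Commute.smul_right ?_ _)
  · unfold hubbardFermionInteraction
    simp only [cAt, annihilation_conjTranspose]
    refine Commute.add_right (Commute.sum_right _ _ _ fun x _ => ?_)
      (Commute.sum_right _ _ _ fun x _ => Commute.sum_right _ _ _ fun y _ => ?_)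
    · split_ifs
      · exact Commute.smul_right (spinFlip_commute_numberOp_mul_numberOp (PolySite.pt x.1 x.2)) _
      · exact Commute.zero_right _
    · split_ifs
      · exact Commute.smul_right (spinFlip_commute_hopping (PolySite.pt x.1 x.2) (PolySite.pt y.1 y.2)) _
      · exact Commute.zero_right _
  · unfold diagHoppingFermionInteraction
    simp only [cAt, annihilation_conjTranspose]
    refine Commute.sum_right _ _ _ fun x _ => Commute.sum_right _ _ _ fun y _ => ?_
    split_ifs
    · exact Commute.smul_right (spinFlip_commute_hopping (PolySite.pt x.1 x.2) (PolySite.pt y.1 y.2)) _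
    · exact Commute.zero_right _
  · unfold numberInteraction
    refine Commute.sum_right _ _ _ fun x _ => ?_
    split_ifs
    · exact spinFlip_commute_numberOp_add_numberOp (PolySite.pt x.1 x.2)
    · exact Commute.zero_right _

/-! ### §3 No magnetisation of any kind in any periodic equilibrium state of the zero-field 2D `t–t'` Hubbard model -/

section Hubbard

variable (t t' U μ : ℝ) {β : ℝ} (hβ : 0 ≤ β) {q : Fin 2 → ℕ} {ω : InfVolFermionState 2}
include hβ

/-- **MERMIN–WAGNER FOR THE SPIN-FLIP SYMMETRY OF THE ZERO-FIELD 2D `t–t'` HUBBARD MODEL, periodic equilibrium states**: for every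
`β ≥ 0`, every period `q`, every `q`-periodic equilibrium state `ω` of `gcInteractionTT' t t' U μ 0` and every local `O ∈ 𝔄_Λ` with
`(S⁺_Λ + S⁻_Λ) O − O (S⁺_Λ + S⁻_Λ) = κO`, `κ ≠ 0`: `ω(O) = 0`. [cite: KleinLandauShucker1981] [cite: Ghosh1971] -/
theorem InfVolFermionState.IsPerVarEquilibrium.expect_eq_zero_of_spinFlipCharged_ttPrime
    (h : ω.IsPerVarEquilibrium β q (gcInteractionTT' t t' U μ 0) 1) {Λ : Finset (Site 2)} (O : FermionOp Λ) {κ : ℂ} (hκ : κ ≠ 0)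
    (hO : (spinPlus + spinMinus : FermionOp Λ) * O - O * (spinPlus + spinMinus) = κ • O) : ω.expect Λ O = 0 :=
  h.expect_eq_zero_of_conservedCharge_two (gcInteractionTT'_isHermitian t t' U μ 0) (gcInteractionTT'_isEven t t' U μ 0)
    (gcInteractionTT'_isTranslationInvariant t t' U μ 0) (gcInteractionTT'_hasFiniteRange t t' U μ 0) hβ
    (spinFlipCharge_isHermitian 2) (parityAut_spinFlipCharge 2) (commute_chargeSum_spinFlipCharge_gcInteractionTT' t t' U μ) O hκ
    (by rw [chargeSum_spinFlipCharge]; exact hO)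

/-- **NO LONGITUDINAL MAGNETISATION AT ANY SITE**: `ω(S^z_x) = 0` for every site `x` of every region, in every periodic equilibrium
state of the zero-field 2D `t–t'` Hubbard model at `β ≥ 0` (from the two charged combinations `2S^z_x ± (S⁺_x − S⁻_x)`).
[cite: Ghosh1971] [cite: KomaTasakiPRL1992, p. 3] [cite: KleinLandauShucker1981] -/
theorem InfVolFermionState.IsPerVarEquilibrium.expect_sZAt_eq_zero_ttPrime
    (h : ω.IsPerVarEquilibrium β q (gcInteractionTT' t t' U μ 0) 1) {Λ : Finset (Site 2)} {x : Site 2} (hx : x ∈ Λ) :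
    ω.expect Λ (sZAt x hx) = 0 := by
  have h1 := h.expect_eq_zero_of_spinFlipCharged_ttPrime t t' U μ hβ
    ((2 : ℂ) • sZAt x hx + (sPlusAt x hx - sMinusAt x hx)) (by norm_num : (-2 : ℂ) ≠ 0)
    (spinFlip_commutator_longitudinal_minus (PolySite.pt x hx))
  have h2 := h.expect_eq_zero_of_spinFlipCharged_ttPrime t t' U μ hβ
    ((2 : ℂ) • sZAt x hx - (sPlusAt x hx - sMinusAt x hx)) (by norm_num : (2 : ℂ) ≠ 0)
    (spinFlip_commutator_longitudinal_plus (PolySite.pt x hx))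
  have hsum : ((2 : ℂ) • sZAt x hx + (sPlusAt x hx - sMinusAt x hx)) + ((2 : ℂ) • sZAt x hx - (sPlusAt x hx - sMinusAt x hx)) =
      (4 : ℂ) • sZAt x hx := by
    rw [add_add_sub_cancel, ← add_smul]; norm_num
  have h4 : ω.expect Λ ((4 : ℂ) • sZAt x hx) = 0 := by rw [← hsum, map_add, h1, h2, add_zero]
  rw [map_smul, smul_eq_mul, mul_eq_zero] at h4
  exact h4.resolve_left (by norm_num)

/-- **`ω(n_{x↑} − n_{x↓}) = 0`** at every site, in every periodic equilibrium state of the zero-field 2D `t–t'` Hubbard model.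
[cite: Ghosh1971] [cite: KomaTasakiPRL1992, p. 3] -/
theorem InfVolFermionState.IsPerVarEquilibrium.expect_nAt_sub_nAt_eq_zero_ttPrime
    (h : ω.IsPerVarEquilibrium β q (gcInteractionTT' t t' U μ 0) 1) {Λ : Finset (Site 2)} {x : Site 2} (hx : x ∈ Λ) :
    ω.expect Λ (nAt x hx 0 - nAt x hx 1) = 0 := by
  have e : (nAt x hx 0 - nAt x hx 1 : FermionOp Λ) = (2 : ℂ) • sZAt x hx := by
    rw [sZAt, fermionSpinZ, smul_smul, show (2 : ℂ) * (1 / 2) = 1 by norm_num, one_smul]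
  rw [e, map_smul, h.expect_sZAt_eq_zero_ttPrime t t' U μ hβ hx, smul_zero]

/-- **No transverse magnetisation either**: `ω(S⁺_x) = 0` (charge `2` under `N↑ − N↓`; this needs no `h = 0`, cf.
`IsPerVarEquilibrium.expect_eq_zero_of_spinCharged_ttPrime`, and is recorded here at `h = 0` for completeness).
[cite: KomaTasakiPRL1992, p. 3] [cite: KleinLandauShucker1981] -/
theorem InfVolFermionState.IsPerVarEquilibrium.expect_sPlusAt_eq_zero_ttPrime
    (h : ω.IsPerVarEquilibrium β q (gcInteractionTT' t t' U μ 0) 1) {Λ : Finset (Site 2)} {x : Site 2} (hx : x ∈ Λ) :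
    ω.expect Λ (sPlusAt x hx) = 0 := by
  refine h.expect_eq_zero_of_spinCharged_ttPrime t t' U μ 0 hβ (sPlusAt x hx) (by norm_num : (2 : ℂ) ≠ 0) ?_
  -- `(N↑ − N↓) S⁺_x − S⁺_x (N↑ − N↓) = 2 S⁺_x`
  have key : ∀ p : PolySite Λ, (numberOp p 0 - numberOp p 1) * fermionSpinPlus (PolySite.pt x hx) -
      fermionSpinPlus (PolySite.pt x hx) * (numberOp p 0 - numberOp p 1) =
        if PolySite.pt x hx = p then (2 : ℂ) • fermionSpinPlus (PolySite.pt x hx) else 0 := by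
    intro p
    simp only [numberOp, fermionSpinPlus, Matrix.sub_mul, Matrix.mul_sub]
    have ha := LiebThm1.creation_mul_annihilation_commutator (orb p 0) (orb p 0) (orb (PolySite.pt x hx) 0) (orb (PolySite.pt x hx) 1)
    have hb := LiebThm1.creation_mul_annihilation_commutator (orb p 1) (orb p 1) (orb (PolySite.pt x hx) 0) (orb (PolySite.pt x hx) 1)
    simp only [orb_eq_orb_iff, and_true, Fin.isValue, zero_ne_one, and_false, if_false, sub_zero, one_ne_zero, zero_sub] at ha hb
    rw [show ∀ A B P : FermionOp Λ, A * P - B * P - (P * A - P * B) = (A * P - P * A) - (B * P - P * B) from fun A B P => by abel,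
      ha, hb]
    by_cases hp : PolySite.pt x hx = p
    · subst hp
      simp only [if_true, two_smul]
      abel
    · have hp' : ¬ p = PolySite.pt x hx := fun h' => hp h'.symm
      simp [hp, hp']
  rw [spinImbalance, Finset.sum_mul, Finset.mul_sum, ← Finset.sum_sub_distrib]
  simp_rw [key]
  rw [Finset.sum_ite_eq, if_pos (Finset.mem_univ _)]

/-- `ω(S⁻_x) = 0`. [cite: KomaTasakiPRL1992, p. 3] [cite: KleinLandauShucker1981] -/
theorem InfVolFermionState.IsPerVarEquilibrium.expect_sMinusAt_eq_zero_ttPrime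
    (h : ω.IsPerVarEquilibrium β q (gcInteractionTT' t t' U μ 0) 1) {Λ : Finset (Site 2)} {x : Site 2} (hx : x ∈ Λ) :
    ω.expect Λ (sMinusAt x hx) = 0 := by
  have h1 := h.expect_sPlusAt_eq_zero_ttPrime t t' U μ hβ hx
  have h2 := ω.expect_conjTranspose Λ (sPlusAt x hx)
  rw [h1, star_zero, sPlusAt, conjTranspose_fermionSpinPlus] at h2
  exact h2

/-- **THE STAGGERED MAGNETISATION OF EVERY PERIODIC EQUILIBRIUM STATE VANISHES**: no Néel order (and, by
`expect_sZAt_eq_zero_ttPrime`, no ferro-, ferri-, spiral or stripe magnetisation of any period) in the zero-field two-dimensional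
`t–t'` Hubbard model at any `β ≥ 0`, for every `q`-periodic equilibrium state. [cite: Ghosh1971] [cite: KomaTasakiPRL1992, p. 3] -/
theorem InfVolFermionState.IsPerVarEquilibrium.staggeredMagnetisation_eq_zero_ttPrime
    (h : ω.IsPerVarEquilibrium β q (gcInteractionTT' t t' U μ 0) 1) : ω.staggeredMagnetisation = 0 := by
  unfold InfVolFermionState.staggeredMagnetisation
  rw [Finset.sum_eq_zero fun c _ => ?_, mul_zero]
  rw [h.expect_nAt_sub_nAt_eq_zero_ttPrime t t' U μ hβ (Finset.mem_singleton_self _), Complex.zero_re, mul_zero]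

/-! ### §4 Translation-invariant equilibrium states -/

/-- **No magnetisation in any translation-invariant equilibrium state** of the zero-field 2D `t–t'` Hubbard model (`β ≥ 0`):
`ω(S^z_x) = 0` (a translation-invariant equilibrium state is a periodic one, `IsVarEquilibrium.isPerVarEquilibrium`).
[cite: Ghosh1971] [cite: KomaTasakiPRL1992, p. 3] -/
theorem InfVolFermionState.IsVarEquilibrium.expect_sZAt_eq_zero_ttPrime (h : ω.IsVarEquilibrium β (gcInteractionTT' t t' U μ 0) 1)
    {Λ : Finset (Site 2)} {x : Site 2} (hx : x ∈ Λ) : ω.expect Λ (sZAt x hx) = 0 :=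
  (h.isPerVarEquilibrium two_pos (gcInteractionTT'_isTranslationInvariant t t' U μ 0) 0).expect_sZAt_eq_zero_ttPrime t t' U μ hβ hx

/-- `ω(O) = 0` for every spin-flip-charged local `O`, translation-invariant equilibrium states. [cite: KleinLandauShucker1981] [cite: Ghosh1971] -/
theorem InfVolFermionState.IsVarEquilibrium.expect_eq_zero_of_spinFlipCharged_ttPrime
    (h : ω.IsVarEquilibrium β (gcInteractionTT' t t' U μ 0) 1) {Λ : Finset (Site 2)} (O : FermionOp Λ) {κ : ℂ} (hκ : κ ≠ 0)
    (hO : (spinPlus + spinMinus : FermionOp Λ) * O - O * (spinPlus + spinMinus) = κ • O) : ω.expect Λ O = 0 :=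
  (h.isPerVarEquilibrium two_pos (gcInteractionTT'_isTranslationInvariant t t' U μ 0) 0).expect_eq_zero_of_spinFlipCharged_ttPrime
    t t' U μ hβ O hκ hO

end Hubbard

/-! ### §5 The staggered-field Hubbard family at zero staggered field -/

/-- Two interactions with the same terms are equal. [folklore] -/
private theorem FermionInteraction.ext_of_apply' {Ψ₁ Ψ₂ : FermionInteraction d} (h : ∀ X, Ψ₁.Φ X = Ψ₂.Φ X) : Ψ₁ = Ψ₂ := by
  cases Ψ₁; cases Ψ₂; congr 1; funext X; exact h X

/-- **At zero staggered field the `(2ℤ)²`-periodic staggered-field Hubbard family IS the zero-field `t–t'` model with `t' = 0`**: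
`hubbardStaggered 2 t U θ = gcInteractionTT' t 0 U (−θ₀) 0` when `θ₁ = 0` (`PeriodicSublatticeAndStaggeredTerms`: `θ = (−μ, −h_s)`).
[cite: KomaTasaki1994, §1] -/
theorem hubbardStaggered_two_eq_gcInteractionTT' (t U : ℝ) {θ : Fin 2 → ℝ} (hθ : θ 1 = 0) :
    hubbardStaggered 2 t U θ = gcInteractionTT' t 0 U (-θ 0) 0 := by
  refine FermionInteraction.ext_of_apply' fun X => ?_
  have h0 : (diagHoppingFermionInteraction 0).Φ X = 0 := by
    unfold diagHoppingFermionInteraction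
    simp
  rw [hubbardStaggered, gcInteractionTT', FermionInteraction.linearFamily_apply, FermionInteraction.linearFamily_apply,
    hubbardTTPrimeFermionInteraction_apply, h0, add_zero, Fin.sum_univ_two, Fin.sum_univ_two]
  simp only [Matrix.cons_val_zero, Matrix.cons_val_one, hθ, neg_neg, neg_zero, Complex.ofReal_zero, zero_smul, add_zero]

section Staggered

variable (t U : ℝ) {θ : Fin 2 → ℝ} {β : ℝ} (hβ : 0 ≤ β) {q : Fin 2 → ℕ} {ω : InfVolFermionState 2}
include hβ

/-- **AT ZERO STAGGERED FIELD EVERY PERIODIC EQUILIBRIUM STATE OF THE 2D HUBBARD MODEL HAS ZERO STAGGERED MAGNETISATION** (any `β ≥ 0`,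
any chemical potential `−θ₀`, any period `q`; in particular the `(2ℤ)²`-periodic equilibrium states of `exists_isPerVarEquilibrium_hubbardStaggered`):
the conjugate observable of the staggered field vanishes identically on the equilibrium states at `h_s = 0`, so Néel order at `T > 0`
in `d = 2` can live only in correlations, never in a one-point function. [cite: Ghosh1971] [cite: KomaTasakiPRL1992, p. 3] [cite: KleinLandauShucker1981] -/
theorem InfVolFermionState.IsPerVarEquilibrium.staggeredMagnetisation_eq_zero_hubbardStaggered
    (h : ω.IsPerVarEquilibrium β q (hubbardStaggered 2 t U θ) 1) (hθ : θ 1 = 0) : ω.staggeredMagnetisation = 0 := by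
  rw [hubbardStaggered_two_eq_gcInteractionTT' t U hθ] at h
  exact h.staggeredMagnetisation_eq_zero_ttPrime t 0 U (-θ 0) hβ

/-- `ω(S^z_x) = 0` at every site, for every periodic equilibrium state of the 2D Hubbard model at zero staggered field.
[cite: Ghosh1971] [cite: KomaTasakiPRL1992, p. 3] -/
theorem InfVolFermionState.IsPerVarEquilibrium.expect_sZAt_eq_zero_hubbardStaggered
    (h : ω.IsPerVarEquilibrium β q (hubbardStaggered 2 t U θ) 1) (hθ : θ 1 = 0) {Λ : Finset (Site 2)} {x : Site 2} (hx : x ∈ Λ) :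
    ω.expect Λ (sZAt x hx) = 0 := by
  rw [hubbardStaggered_two_eq_gcInteractionTT' t U hθ] at h
  exact h.expect_sZAt_eq_zero_ttPrime t 0 U (-θ 0) hβ hx

end Staggered

end Literature.MathematicalPhysics.QuantumLattice

end
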